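import Summits.BirchSwinnertonDyer.BirchSwinnertonDyer.Theorems.ByReductionTypeAtTwoOrdKatoHalfAtTwoIsoChebotarevR4
import Summits.BirchSwinnertonDyer.BirchSwinnertonDyer.Theorems.ByReductionTypeAtTwoOrdKatoHalfAtTwoIsoRubinTauAtTwo
import HarnessLib

/-!
# Route ByReductionTypeAtTwo, crux `OrdKatoHalfAtTwoIso` (stmt-BirchSwinnertonDyer-19573), line `steinberg-fibre-at-two`
# (skeleton v11), stub `stub_coreA_posDisc : CoreTheoremAPosDiscTwo` (child 23967) — plan item (P3d): H-C⁺ — the statement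
# `ChebotarevTranspositionTwo` with `Δ < 0` replaced by «`2Δ ∉ ℚ^{×2}` and `0 < Δ`» AND the extra output `Fr ∈ Gal(ℚ̄/ℚ(μ_4))`

Seat `cruxlead-stmt-BirchSwinnertonDyer-19573-g5` (LEAD PROVER, MODE LINE; HOME `run/shared/lean/pub/bsd-2adic/`; `--supports`
stmt-BirchSwinnertonDyer-19573 as helper). THEOREMS ONLY; nothing asserted; BSD is not proved by any of this; the crux and the stub are
NOT proved here.

WHY. This is the Ω1 input of the `0 < Δ` assembly (brief (P4)): exactly w2's `chebotarevTransposition_two_of_isCyclotomic` (p681540)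
plus `Fr ∈ rootsOfUnityFixer ℚ 4` — so that the Kolyvagin prime `q` below `𝔓` satisfies `4 ∣ ℓ − 1` (`…FrobeniusModFour`, p689168)
and the real component of its Kolyvagin class vanishes (`exists_kolyvaginPackage_two_realZero`, p688788). The transposition is Rubin's
`τ` (p682874 `exists_mem_kerSubgroup_transposition_smul_sqrt_neg_one_eq`: `τ ∈ ker κ`, odd on `E[2]`, `τ·i = i`; its hypotheses
`−Δ, −2Δ ∉ ℚ^{×2}` are automatic at `0 < Δ`), which fixes `μ_4 = {±1, ±i}`; the Chebotarev step is `…ChebotarevR4` (p690048).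

References: B. Mazur, K. Rubin, Mem. AMS 799 (2004) §3.6, Prop. 1.3.2 [MazurRubin2004]; K. Rubin, *Euler Systems* (2000) Hyp(K,T)(b)
[Rubin2000]; tree p681540 (parent statement), p682874, p690048.
-/

set_option autoImplicit false
set_option linter.dupNamespace false

noncomputable section

open scoped NumberField
open Field WeierstrassCurve Function IsDedekindDomain NumberField
open Literature.NumberTheory.EllipticCurves Literature.NumberTheory.GaloisRepresentations
open Literature.NumberTheory.EllipticCurves.DokchitserDokchitser2012
open Summit.BirchSwinnertonDyer.BirchSwinnertonDyer.Rank1Residual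

-- D-0017: single-problem summit, so `Summit.BirchSwinnertonDyer.BirchSwinnertonDyer.…` repeats a namespace BY DESIGN.
namespace Summit.BirchSwinnertonDyer.BirchSwinnertonDyer.Theorems.SteinbergFibreAtTwo

/-- **(H-C⁺) for the cyclotomic tower at `0 < Δ`, with the Frobenius FIXING `μ_4`**: the displayed statement
`ChebotarevTranspositionTwo` of `…OmegaRoadDefs` §2 with `W.Δ < 0` REPLACED by `¬ IsSquare (2 * W.Δ)` ∧ `0 < W.Δ`, and the extra
conclusion `Fr ∈ rootsOfUnityFixer ℚ 4` (so `q ≡ 1 (mod 4)`). Proof: Rubin's `τ` (p682874) fixes `±1, ±i` hence `μ_4`; feed it to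
`exists_isArithFrobAt_transposition_mem_rootsOfUnityFixer_weilPairingHom_ne_zero` with the deeper bottom-cocycle witnesses.
[cite: MazurRubin2004, §3.6 and Prop. 1.3.2] [cite: Rubin2000, Hyp(K,T) (b), §2.1] -/
theorem chebotarevTransposition_two_mem_rootsOfUnityFixer_of_pos :
    ∀ (W : WeierstrassCurve ℚ) [W.IsElliptic] [W.IsGloballyMinimal] (κ : ZpExtension ℚ 2)
      (γ : absoluteGaloisGroup ℚ),
      W.HasSurjectiveModNGaloisRep 2 → ¬ IsSquare (2 * W.Δ) → 0 < W.Δ → κ.IsCyclotomic → κ.IsTopGenerator γ →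
      ∀ (κ' : κ.twistTower (W.torsionGaloisModule (2 : ℤ))
          (fun P : WeierstrassCurve.geomTorsion W (2 : ℤ) => AddSubgroup.torsionBy.nsmul P)),
        κ.towerConst (W.torsionGaloisModule (2 : ℤ)) (fun P => AddSubgroup.torsionBy.nsmul P) κ' ≠ 0 →
      ∀ (J : ℕ) (φ : contOneCocycles (W.modPTwist 2 κ (J + 1)).toTopRep),
        oneCocycleClass (W.modPTwist 2 κ (J + 1)).toTopRep φ = κ'.1 (J + 1) →
      ∀ (ψ : contOneCocycles (W.modPTwist 2 κ.invTwist (J + 1)).toTopRep),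
        (κ.invTwist.shiftH1 (W.torsionGaloisModule (2 : ℤ))
            (fun P : WeierstrassCurve.geomTorsion W (2 : ℤ) => AddSubgroup.torsionBy.nsmul P) (J + 1))^[J]
          (oneCocycleClass (W.modPTwist 2 κ.invTwist (J + 1)).toTopRep ψ) ≠ 0 →
      ∀ (eW : WeierstrassCurve.geomTorsion W (2 : ℤ) → WeierstrassCurve.geomTorsion W (2 : ℤ) →
          AlgebraicClosure ℚ)
        (hμ : ∀ S T, eW S T ^ 2 = 1)
        (hadd₁ : ∀ S₁' S₂' T, eW (S₁' + S₂') T = eW S₁' T * eW S₂' T)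
        (hadd₂ : ∀ S T₁ T₂, eW S (T₁ + T₂) = eW S T₁ * eW S T₂),
        (∀ T, eW T T = 1) → (∀ T, (∀ S, eW S T = 1) → T = 0) →
        (∀ (σ : absoluteGaloisGroup ℚ) (S T : WeierstrassCurve.geomTorsion W (2 : ℤ)),
          σ • eW S T = eW (σ • S) (σ • T)) →
      ∀ (S : Set (HeightOneSpectrum (𝓞 ℚ))), S.Finite → ∀ (n : ℕ),
      ∃ q : HeightOneSpectrum (𝓞 ℚ), q ∉ S ∧ ∃ 𝔓 ∈ q.primesAbove, ∃ Fr : absoluteGaloisGroup ℚ,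
        IsArithFrobAt (𝓞 ℚ) Fr 𝔓 ∧
        WeierstrassCurve.galoisRepTorsion W 2 Fr ≠ 1 ∧ WeierstrassCurve.galoisRepTorsion W 2 (Fr * Fr) = 1 ∧
        Fr ∈ κ.layerSubgroup n ∧ Fr ∈ rootsOfUnityFixer ℚ 4 ∧
        weilPairingHom W 2 eW hμ hadd₁ hadd₂ (Fr • φ.1 Fr ⟨0, Nat.succ_pos J⟩ - φ.1 Fr ⟨0, Nat.succ_pos J⟩)
          (ψ.1 Fr ⟨0, Nat.succ_pos J⟩) ≠ 0 := by
  intro W _ _ κ _ h2 h2Δ hΔ hκ _ κ' hκ' J φ hφ ψ hψ eW hμ hadd₁ hadd₂ halt hnondeg _ S hS n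
  -- `−Δ`, `−2Δ` are negative, hence not squares
  have hnΔ : ¬ IsSquare (-W.Δ) := fun ⟨r, hr⟩ => by nlinarith [mul_self_nonneg r]
  have hn2Δ : ¬ IsSquare (-2 * W.Δ) := fun ⟨r, hr⟩ => by nlinarith [mul_self_nonneg r]
  -- Rubin's `τ`: a transposition in `ker κ` fixing `i = √−1`, hence fixing `μ_4 = {±1, ±i}`
  obtain ⟨i, hi⟩ : ∃ i : AlgebraicClosure ℚ, i ^ 2 = -1 := by
    obtain ⟨z, hz⟩ := IsAlgClosed.exists_eq_mul_self (-1 : AlgebraicClosure ℚ)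
    exact ⟨z, by rw [pow_two, ← hz]⟩
  obtain ⟨τ, hτκ, hsign, hτi⟩ :=
    exists_mem_kerSubgroup_transposition_smul_sqrt_neg_one_eq W κ hκ h2 h2Δ hnΔ hn2Δ hi
  have hτ4 : τ ∈ rootsOfUnityFixer ℚ 4 := by
    rw [mem_rootsOfUnityFixer_iff]
    intro t ht
    have hfac : (t ^ 2 - 1) * (t ^ 2 + 1) = 0 := by
      have : t ^ 4 - 1 = 0 := by rw [ht, sub_self]
      calc (t ^ 2 - 1) * (t ^ 2 + 1) = t ^ 4 - 1 := by ring
        _ = 0 := this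
    rcases mul_eq_zero.mp hfac with h1 | h1
    · -- `t² = 1`: `t = ±1` is rational, fixed
      have ht2 : (t - 1) * (t + 1) = 0 := by
        calc (t - 1) * (t + 1) = t ^ 2 - 1 := by ring
          _ = 0 := h1
      rcases mul_eq_zero.mp ht2 with h | h
      · rw [sub_eq_zero.mp h]; exact smul_one τ
      · rw [eq_neg_of_add_eq_zero_left h, smul_neg, smul_one]
    · -- `t² = −1 = i²`: `t = ±i`, fixed since `τ i = i`
      have ht2 : (t - i) * (t + i) = 0 := by
        calc (t - i) * (t + i) = t ^ 2 - i ^ 2 := by ring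
          _ = 0 := by rw [hi]; exact sub_eq_zero.mpr (eq_neg_of_add_eq_zero_left h1)
      rcases mul_eq_zero.mp ht2 with h | h
      · rw [sub_eq_zero.mp h]; exact hτi
      · rw [eq_neg_of_add_eq_zero_left h, smul_neg, hτi]
  obtain ⟨q, hq, 𝔓, h𝔓, Fr, hFr, hρ1, hρ2, hFrn, hFr4, hne⟩ :=
    exists_isArithFrobAt_transposition_mem_rootsOfUnityFixer_weilPairingHom_ne_zero W κ h2 hτκ hτ4 hsign _ _
      (exists_mem_inf_rootsOfUnityFixer_constCoeff_apply_ne_zero_of_towerConst_ne_zero W κ hκ h2 h2Δ κ' hκ' J φ hφ)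
      (exists_mem_inf_rootsOfUnityFixer_constCoeff_apply_ne_zero_of_shiftH1_iterate_ne_zero W κ hκ h2 h2Δ J ψ hψ)
      eW hμ hadd₁ hadd₂ halt hnondeg S hS n
  exact ⟨q, hq, 𝔓, h𝔓, Fr, hFr, hρ1, hρ2, hFrn, hFr4, hne⟩

end Summit.BirchSwinnertonDyer.BirchSwinnertonDyer.Theorems.SteinbergFibreAtTwo

end
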